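import Mathlib.GroupTheory.Torsion
import Mathlib.Algebra.Group.Subgroup.Basic
import Mathlib.Tactic
import HarnessLib

/-!
# Crux `PrintCf2.SplitBadTwoRankOneOfFacts` (stmt-BirchSwinnertonDyer-20368), road α v11.1, S3b′ brick (FIN) via (ET), piece (B1) file 3:
# PURE ALGEBRA — a subgroup of `W* ⊕ W*′` containing the line `W*′` and missing one `2`-torsion point IS the line `W*′`

Cell `bsd-print-cf2`, EXTRA WIDTH seat `bsd-line-cf2-p1-w8` g3 (prover-bsd-line-cf2-p1-w8-g3-0); `--supports stmt-BirchSwinnertonDyer-20368`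
(helper, Theses-free). HONEST FRAMING: nothing here closes the crux or a registered stub; BSD is not proved by any of this; no summit
statement is proved by this seat. No definition, no named fact, no `sorry`, no kit. beyond-print theorem: no.

WHY (step (iii) of TURNKEY-20368-ET-w3g10 §2 (B1): «the transported kernel of reduction IS the CM summand»). After p685969/p686370 the (ET) seat
holds, at a dyadic place `w` of a frame, a `Γ_{K_w}`-stable subgroup `𝒦′ ≤ E(K̄_w)` with Greenberg's Kummer compatibility and a `2`-torsion point
`T ∉ 𝒦′`. The torsion part `𝒞 = {m ∈ E[2^∞] : m ∈ 𝒦′}` must be shown to be the kernel line `W*′` (at `v`; `W*` at `v̄`). THIS FILE is the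
UPPER BOUND as pure algebra: in a `2`-primary abelian group `A` with an additive `e : A → M` with `x − e x ∈ M′` (the projector onto `M` along `M′`) and
`M[2]` cyclic of order `≤ 2` (the CM summands: -w2 `CMPrimes.endEigenPrimaryTorsion_two_structure`), every subgroup `𝒞 ⊇ M′` which misses some
`2`-torsion point `T` is contained in `M′` — hence `𝒞 = M′`. (If `x ∈ 𝒞` had `e x ≠ 0`, a `2`-power multiple of `e x` would be THE point of
order `2` of `M`, which is also `e T`; then `T = (T − eT) + eT ∈ 𝒞`.) The LOWER bound `M′ ≤ 𝒞` is the remaining local input (an inertia element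
fixing `√d` acting on the divisible `W*′` by a scalar `≠ 1`, with `σm − m ∈ 𝒞`).
* `exists_nsmul_two_pow_ne_zero_and_two_nsmul_eq_zero` — a nonzero `2`-primary element has a multiple of order exactly `2`.
* **`le_of_compl_line_le_of_not_mem`** — the statement above; **`eq_of_compl_line_le_of_not_mem`** — `𝒞 = M′`.
presearch: elementary; no source needed beyond [Rubin1999] §2 (the decomposition `E[p^∞] = W* ⊕ W*′`). playbook: none fit.

References: [Rubin1999] §2; [GreenbergLNM1716] §2 p. 70.
-/

set_option linter.dupNamespace false
set_option autoImplicit false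

namespace Summit.BirchSwinnertonDyer.BirchSwinnertonDyer.Theorems.PrintCf2.ReductionKernel

variable {A : Type*} [AddCommGroup A]

/-- A nonzero element killed by a power of `2` has a `2`-power multiple of order exactly `2`. [folklore] -/
theorem exists_nsmul_two_pow_ne_zero_and_two_nsmul_eq_zero {x : A} (hx : x ≠ 0) {j : ℕ} (hj : 2 ^ j • x = 0) :
    ∃ k : ℕ, 2 ^ k • x ≠ 0 ∧ 2 • (2 ^ k • x) = 0 := by
  induction j generalizing x with
  | zero =>
    rw [pow_zero, one_smul] at hj
    exact absurd hj hx
  | succ j ih =>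
    by_cases h2 : 2 • x = 0
    · exact ⟨0, by rwa [pow_zero, one_smul], by rwa [pow_zero, one_smul]⟩
    · obtain ⟨k, hk, hk2⟩ := ih h2 (by rwa [pow_succ, mul_smul] at hj)
      refine ⟨k + 1, ?_, ?_⟩
      · rwa [pow_succ, mul_smul]
      · rwa [pow_succ, mul_smul]

/-- **UPPER BOUND FOR A SUBGROUP BETWEEN A LINE AND THE WHOLE.** Let `A` be a `2`-primary abelian group with subgroups `M, M′`, an additive
`e : A → M` with `x − e x ∈ M′` for all `x` (e.g. the projector onto `M` along `M′`), and suppose `M[2]` has at most one nonzero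
element. If a subgroup `𝒞 ⊇ M′` misses some `T` with `2T = 0`, then `𝒞 ≤ M′`. [cite: Rubin1999, §2] -/
theorem le_of_compl_line_le_of_not_mem (hA : ∀ x : A, ∃ j : ℕ, 2 ^ j • x = 0) (M M' 𝒞 : AddSubgroup A) (e : A →+ ↥M)
    (hsub : ∀ x : A, x - (e x : A) ∈ M')
    (hM2 : ∀ a ∈ M, ∀ b ∈ M, 2 • a = 0 → 2 • b = 0 → a ≠ 0 → b ≠ 0 → a = b)
    (hlow : M' ≤ 𝒞) {T : A} (hT2 : 2 • T = 0) (hT : T ∉ 𝒞) : 𝒞 ≤ M' := by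
  intro x hx
  -- `e T ≠ 0` and `e T ∉ 𝒞`
  have heT𝒞 : (e T : A) ∉ 𝒞 := fun h ↦ hT (by
    have : T = (T - (e T : A)) + (e T : A) := (sub_add_cancel T _).symm
    rw [this]
    exact 𝒞.add_mem (hlow (hsub T)) h)
  have heT0 : (e T : A) ≠ 0 := fun h ↦ heT𝒞 (h ▸ 𝒞.zero_mem)
  have heT2 : 2 • (e T : A) = 0 := by
    rw [← AddSubmonoidClass.coe_nsmul, ← map_nsmul, hT2, map_zero, ZeroMemClass.coe_zero]
  -- if `e x ≠ 0`, a multiple of it is THE point of order two of `M`, i.e. `e T`, which would lie in `𝒞`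
  by_cases hex : (e x : A) = 0
  · have : x = (x - (e x : A)) := by rw [hex, sub_zero]
    rw [this]
    exact hsub x
  · exfalso
    have hex𝒞 : (e x : A) ∈ 𝒞 := by
      have : (e x : A) = x - (x - (e x : A)) := (sub_sub_cancel x _).symm
      rw [this]
      exact 𝒞.sub_mem hx (hlow (hsub x))
    obtain ⟨j, hj⟩ := hA (e x : A)
    obtain ⟨k, hk0, hk2⟩ := exists_nsmul_two_pow_ne_zero_and_two_nsmul_eq_zero hex hj
    have hkM : 2 ^ k • (e x : A) ∈ M := M.nsmul_mem (e x).2 _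
    have heq : 2 ^ k • (e x : A) = (e T : A) := hM2 _ hkM _ (e T).2 hk2 heT2 hk0 heT0
    exact heT𝒞 (heq ▸ 𝒞.nsmul_mem hex𝒞 _)

/-- **THE SUBGROUP IS THE LINE**: under the hypotheses of `le_of_compl_line_le_of_not_mem`, `𝒞 = M′`. [cite: Rubin1999, §2] -/
theorem eq_of_compl_line_le_of_not_mem (hA : ∀ x : A, ∃ j : ℕ, 2 ^ j • x = 0) (M M' 𝒞 : AddSubgroup A) (e : A →+ ↥M)
    (hsub : ∀ x : A, x - (e x : A) ∈ M')
    (hM2 : ∀ a ∈ M, ∀ b ∈ M, 2 • a = 0 → 2 • b = 0 → a ≠ 0 → b ≠ 0 → a = b)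
    (hlow : M' ≤ 𝒞) {T : A} (hT2 : 2 • T = 0) (hT : T ∉ 𝒞) : 𝒞 = M' :=
  le_antisymm (le_of_compl_line_le_of_not_mem hA M M' 𝒞 e hsub hM2 hlow hT2 hT) hlow

end Summit.BirchSwinnertonDyer.BirchSwinnertonDyer.Theorems.PrintCf2.ReductionKernel
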